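import Summits.QuantumFields.YangMills.Theorems.BalabanUVNodesK0AxDecayBoxD9Junction

/-!
# BalabanUVNodes — K0ᴬ–K1ᴬ junction: the finite-volume continuity letter (V-cont-box) from the HISTORY-CONTINUITY OF THE STEP FUNCTIONAL's HESSIAN; the junction's `hβc` over
  D1-box + the chart rows + that row + the signed floor letter  (★ P3 g90 `ym-nodeO-ideate-p3`, LENS P3 «weaken the target», №10 v1.1; after ★ P3 №9 v2.1 PART 1∕2 `…K0AxDecayBoxD9` + PART 2∕2 `…K0AxDecayBoxD9Junction` (offered); tree names only)

LANDING NOTE (porter ▶ PTC-1 g4, 2026-08-31; AUTHORSHIP = ★ P3 g90 «weaken the target», HOME sketch `nodeO-cover/P3-K0AxJunctionHessBox-v1p1.lean` sha16 d33e2be68a1d0744 · 177 l. · 5 thm · 0 def ·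
0 sorry (= v1 a568b406 with its one import re-pointed to `…K0AxDecayBoxD9Junction`)): landed VERBATIM (only this paragraph added) under P3's basename (`…K0AxJunctionHessBoxD9`) on OFFER №10 (nodeO
STATUS 10:16:10Z ∕ 10:20:55Z), after ✓`…K0AxDecayBoxD9` + ✓`…K0AxDecayBoxD9Junction`; ◆ CRIT-1 g37's cut of №10 (§12a generic `ContinuousOn` step + (V-cont-box) ⟸ (V-hess-cont-box); §12b junction
editions): CUT ×3 GO (nodeO STATUS 2026-08-31T10:44:10Z): combined farm run of №9A+№9B+№10 rc 0 · 0 warn · 0 sorry, axioms standard through №10's last door, dedup 16∕16 fresh, (Q-ord) PASS (every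
`∃ C₉ δ₀`∕`∃ C δ₁`∕`∃ M` closed inside after `δ₀` is revealed), J1′∕J5′ PASS, SAME-WALL: located-genuine CONDITIONAL helpers whose price is every conjunct of `H` OPEN — incl. the one honest gap
the files name themselves: D1 is asked at every BOX history while ⁸∕⟨27930⟩ as signed delivers RUNS (Q-25, ★★★'s pen); helper `--supports stmt-QuantumFields-27238 --as helper` (NO `--workitem`).
HONEST (porter): CONDITIONAL theorems over DISPLAYED row predicates + by-name doors from displayed
hypotheses; (E-lu-box) ∕ (L-dec-box) ∕ [E] inhabited unconditionally NOWHERE; D1-on-the-box, the chart rows of ONE `ιC`, (V-cont-box) ∕ (V-hess-cont-box), the sign letters — all OPEN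
Bałaban-strength content, asserted nowhere; nothing of Bałaban asserted, ported, discharged or refuted; K0ᴬ stmt-QuantumFields-27238 OPEN — NOTHING of it proved; NODE O 0∕1; COUNT 8∕28 · K 1∕4
UNMOVED; finite 𝕋⁴ at fixed ε — NOT continuum ∕ OS ∕ Clay; the Yang–Mills mass gap is NOT proved by any of this.

WHY THIS FILE (LENS P3).  After №9 v2.1 the junction's binder `hβc` (✓`…K0AxJunction`; body ✓`K0AxMomentBoxSocket.CofinalBetaSocketAxBody`) is fed by D1-box + the chart rows of ONE `ιC` +
TWO displayed letters: the finite-volume continuity (V-cont-box) `RecordPvolContOnBoxAx F a₀ ε₂₉ γ₀` (`∀ k z, ∃ᶠ K, ContinuousOn (v ↦ Π^{T_K}_{k+1}(v; z)₀₁) (Box γ₀ k)`) and the signed floor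
letter.  (V-cont-box) is a statement about the WINDOWED, TRACED, BASIS-READ kernel; its content is upstream: `Π^{T_K}_{k+1}(v; z)₀₁ = (dim 𝔤)⁻¹ Σ_a D²(𝐄^{(k+1)}_{T_K}(v; exp ρ₈ ·))(0)[δ_{0,z}T_a, δ_{1,0}T_a]`
(`recordPvolAx` = `pvolOf` = `polWindow` ∘ `polScalar` ∘ `polComp` ∘ `polTensor`, all definitional), so (V-cont-box) follows at EVERY volume from the continuity in the history `v` of the
Hessian at the origin of the step functional `B ↦ 𝐄^{(k+1)}_{T_K}(v; exp ρ₈ B)` — the form in which print states it ([I] p.264 «smooth functions of g_j»; p.266 the analytic alternative;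
p.298) and in which a construction-side proof for `recordTermsAx` (= `mergedTermFamilyMatT F 2 (TβOfRecord₁₃ F 2) (chiβOfRecord₁₃Ax …) εbg`) would deliver it.

THIS FILE (sorry-free; every hypothesis displayed; tree names only; namespace `…Theorems.K0AxMomentRoad`):
* §12a `continuousOn_polWindow_of_hessCont` (generic calculus step: `x ↦ polWindow F K j (ℰ x) ρ bV μ ν z` is continuous where `x ↦ D²(expChart (ℰ x) ρ)(0)` is) and
  ★★ `recordPvolContOnBoxAx_of_hessContOnBox` — (V-cont-box) ⟸ (V-hess-cont-box) `∀ k K, ContinuousOn (v ↦ fderiv ℝ (fderiv ℝ (expChart (recordTermsAx F a₀ ε₂₉ k v K) θ.ρ8)) 0) (Box γ k)`.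
* §12b ★★ `cofinalBetaSocketAxBody_of_chartRowsBox_hessBox_negPart` — the junction socket body at ONE radius from D1-box + chart rows + (V-hess-cont-box) + (L-negpart-box) (№9 v2 §11h ∘ §12a);
  ★ `cofinalBetaSocketAxBody_allRadii_of_chartRowsBox_hessBox_negPart_cofinalRadii` — the junction's `hβc` VERBATIM at cofinally small radii; ★ `record13SepCoPHInhabitedAx_of_chartRowsBox_hessBox_negPart_cofinalRadii` — K0ᴬ BY NAME through it.

NET FOR THE JUNCTION (LENS P3, v5 §9 sharpened): `hβc` ⟸ D1 on the box ∧ the chart rows of ONE `ιC` ∧ guards ∧ (V-hess-cont-box) ∧ the signed floor letter ((L-negpart-box); the (L-AF-box) edition is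
`…K0AxDecayBoxD9Junction`'s `cofinalBetaSocketAxBody_of_chartRowsBox_contBox_eventuallyNonneg` ∘ §12a by hand).  DEDUP: every name and statement new; no `def` introduced (the Hessian row is displayed inline).  (Q-ord): unchanged from №9 v2.1 (the new row is a plain hypothesis;
`δ₀` still revealed inside before any constant).

HONEST STATUS.  CONDITIONAL helpers over DISPLAYED rows, each OPEN Bałaban-strength content (D1-box = W1 ⟨27930⟩'s consequent AT EVERY BOX HISTORY — ⁸ signs RUNS, G-P3-6-1∕Q-25; the chart rows
⟸ (ra-1)(ra-3)(ra-4) + `DressLink` ⟸ (C-orb); the Hessian's history-continuity; the sign letter).  Nothing of Bałaban's renormalization-group analysis is asserted, ported, discharged or refuted;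
K0ᴬ `Record13SepCoPHInhabitedAx` (stmt-QuantumFields-27238) OPEN; 27930 ∕ 26648 OPEN; NODE O 0∕1; COUNT 8∕28 · K 1∕4 UNMOVED; finite 𝕋⁴_{L^K} at fixed ε — NOT continuum ∕ OS ∕ Clay;
**the Yang–Mills mass gap (Clay) is NOT proved.**

References: T. Bałaban, *Renormalization group approach to lattice gauge field theories. I*, Comm. Math. Phys. 109 (1987) 249–301 [Balaban1987RG1] — Thm 1 p.259, Thm 2 (0.31) p.259,
Thm 3 p.264, (1.18)–(1.22) pp.263–264, p.266, (5.10) p.293, (5.38)–(5.44) pp.296–297, p.298; T. Bałaban, *The variational problem and background fields in renormalization group method for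
lattice gauge theories*, Comm. Math. Phys. 102 (1985) 277–309 [Balaban1985Variational] — Prop. 9 p.309.
-/

noncomputable section

open Filter Topology
open scoped BigOperators Matrix.Norms.L2Operator

namespace Summit.QuantumFields.YangMills.Theorems.K0AxMomentRoad

open Literature.MathematicalPhysics.QuantumFieldTheory.Balaban1983to89
open Literature.MathematicalPhysics.QuantumFieldTheory.Balaban1983to89.Node00 (TermFamily1 siteOfInt polWindow polScalar betaOfRecord₁₃Ax Stage13Params PolLimitExists)
open Literature.MathematicalPhysics.QuantumFieldTheory.Balaban1983to89.T4Continuum (T4Family)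
open Literature.MathematicalPhysics.QuantumFieldTheory.Balaban1983to89.B12FormatPlus
open Literature.MathematicalPhysics.QuantumFieldTheory.Balaban1983to89.B12Decay510 (SiteGeometry GeomLeaf CubeSumLeaf TreeLeaf KernelBound delta1 delta1_pos mixedDeriv)
open Summit.QuantumFields.YangMills.Theorems.K0RecordFormatNames (ΦfOf pvolOf plimOf PlimDecayOnBoxOf PolLimitOnBoxOf)
open Summit.QuantumFields.YangMills.Theorems.PortH (exists_cutTo_clm pvolOf_eq_trace)
open Summit.QuantumFields.YangMills.Theorems.K0RecordFormatNames
open Summit.QuantumFields.YangMills.Theorems.PortHRecordJoin (formatPlusG_chartSwap chartEquivariant_members noInvariantCovector_members chart_cut limit121_members l1_neg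
  kappa₀_std_pos)
open Summit.QuantumFields.YangMills.Theorems.K0PortChart44DAtRecord (chart44DJ_record)
open Summit.QuantumFields.YangMills.Theorems.K0AxJoinT
open Summit.QuantumFields.YangMills.Theorems.PortHRecordRowG (rowG_slot8_at_names mc_pos)
open Literature.MathematicalPhysics.QuantumFieldTheory.Balaban1983to89.FlowStep
open Literature.MathematicalPhysics.QuantumFieldTheory.Balaban1983to89.FlowStepRuns

/-! ## §12a  (V-cont-box) from the history-continuity of the Hessian at the origin -/

/-- **Generic calculus step**: the windowed scalar kernel `polWindow F K j (ℰ x) ρ bV μ ν z` of an `x`-indexed family of functionals is the normalised colour trace of the Hessian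
`D²(expChart (ℰ x) ρ)(0)` on two FIXED one-bond directions (`polWindow` ∘ `polScalar` ∘ `polComp` ∘ `polTensor`, definitional), hence continuous in `x` on any set where that Hessian is.
[cite: Balaban1987RG1, (1.20)–(1.21) p.264] -/
theorem continuousOn_polWindow_of_hessCont {𝔄 : Type*} [NormedRing 𝔄] [NormedAlgebra ℝ 𝔄] {V : Type*} [NormedAddCommGroup V] [NormedSpace ℝ V] {ι : Type*} [Fintype ι]
    {X : Type*} [TopologicalSpace X] {s : Set X} (F : T4Family) (K j : ℕ) (ℰ : X → ((Fin (F.P K).d → Site (F.P K) j → 𝔄) → ℝ)) (ρ : V →L[ℝ] 𝔄) (bV : Module.Basis ι ℝ V)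
    (μ ν : Fin 4) (z : Fin 4 → ℤ) (h : ContinuousOn (fun x => fderiv ℝ (fderiv ℝ (B12PolarizationTensor120.expChart (ℰ x) ρ)) 0) s) :
    ContinuousOn (fun x => polWindow F K j (ℰ x) ρ bV μ ν z) s := by
  simp only [polWindow, polScalar, B12PolarizationTensor120.polComp, B12PolarizationTensor120.polTensor]
  exact continuousOn_const.mul (continuousOn_finsetSum _ fun a _ => (h.clm_apply continuousOn_const).clm_apply continuousOn_const)

/-- ★★ **(V-cont-box) ⟸ (V-hess-cont-box)** — «THE HESSIAN AT THE ORIGIN OF THE k-TH STEP FUNCTIONAL ON THE K-TH TORUS DEPENDS CONTINUOUSLY ON THE BOX HISTORY» ⟹ the junction's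
finite-volume continuity letter: `Π^{T_K}_{k+1}(v; z)₀₁ = recordPvolAx F a₀ ε₂₉ k v K 0 1 z` is the normalised colour trace of `D²(𝐄^{(k+1)}_{T_K}(v; exp ρ₈ ·))(0)` on two fixed one-bond
directions, so it is continuous in `v` on `Box γ k` at EVERY volume `K` (a fortiori `∃ᶠ K`, which is all (V-cont-box) `RecordPvolContOnBoxAx` asks).  The displayed hypothesis is the chart-free,
basis-free, window-free form of (V-cont-box) — [I] p.264 «smooth functions of g_j», p.266 (the analytic alternative), [II-type remark] p.298 «β_j depends also on all preceding coupling
constants»; OPEN here (the term family `recordTermsAx` is constructed — `mergedTermFamilyMatT` over `TβOfRecord₁₃` and the block-axial cut-off — and its `v`-regularity is not in the tree).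
Sorry-free. [cite: Balaban1987RG1, (1.20)–(1.22) p.264, p.266, p.298] -/
theorem recordPvolContOnBoxAx_of_hessContOnBox (F : T4Family) (a₀ ε₂₉ : ℝ) {γ : ℝ}
    (h : letI θ := thetaFill F a₀ ε₂₉; letI := θ.instVβ₁; letI := θ.instVβ₂
      ∀ k K : ℕ, ContinuousOn (fun v : Fin (k + 1) → ℝ => fderiv ℝ (fderiv ℝ (B12PolarizationTensor120.expChart (recordTermsAx F a₀ ε₂₉ k v K) θ.ρ8)) 0) (FlowStep.Box γ k)) :
    RecordPvolContOnBoxAx F a₀ ε₂₉ γ := by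
  intro k z
  refine Filter.Eventually.frequently (Filter.Eventually.of_forall fun K => ?_)
  letI θ := thetaFill F a₀ ε₂₉; letI := θ.instVβ₁; letI := θ.instVβ₂; letI := θ.instιβ
  exact continuousOn_polWindow_of_hessCont F K (k + 1) (fun v : Fin (k + 1) → ℝ => recordTermsAx F a₀ ε₂₉ k v K) θ.ρ8 θ.bV 0 1 z (h k K)

/-! ## §12b  The junction body and its binder `hβc` with (V-cont-box) REPLACED by the Hessian's history-continuity -/

/-- ★★ **THE JUNCTION SOCKET BODY FROM D1-box + THE CHART ROWS + (V-hess-cont-box) + (L-negpart-box) — NO TOKEN, NO KERNEL-LEVEL CONTINUITY LETTER**: ✓`cofinalBetaSocketAxBody_of_chartRowsBox_contBox_negPart`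
(№9 v2.1 §11h, `…K0AxDecayBoxD9Junction`) with its finite-volume continuity letter (V-cont-box) `RecordPvolContOnBoxAx F a₀ ε₂₉ γ₀` supplied by §12a from the displayed Hessian-continuity row.  CONDITIONAL; every row OPEN
Bałaban-strength content; the junction's consumer and K0ᴬ 27238 remain OPEN; the Yang–Mills mass gap is NOT proved.
[cite: Balaban1987RG1, Thm 1 p.259, Thm 2 (0.31) p.259, Thm 3 p.264, (1.18)–(1.22) pp.263–264, p.266, (5.10) p.293, (5.38)–(5.44) pp.296–297; Balaban1985Variational, Prop. 9 p.309] -/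
theorem cofinalBetaSocketAxBody_of_chartRowsBox_hessBox_negPart {E₀ κ Mg a : ℝ} {e : ℕ → ℝ}
    (hE₀ : 0 ≤ E₀) (hκ₀ : 4 * B12TreeDecay.kappa₀ (4 * 2 ^ 4) (2 * 4) ≤ κ) :
    ∀ (F : T4Family) (a₀ ε₂₉ γ₀ α₀ α₁ : ℝ), 0 < a₀ → a₀ ≤ a → 0 < γ₀ → γ₀ ≤ 1 / 2 → 0 < ε₂₉ → 0 < α₀ → 0 < α₁ →
      ∀ Mc : ℕ, McGuard F Mc → 4 * (Mc : ℝ) ≤ Mg →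
      letI θ := thetaFill F a₀ ε₂₉; letI := θ.instVβ₁; letI := θ.instVβ₂; letI := θ.instιβ
      ∀ ιC : (k n : ℕ) → recordW F a₀ ε₂₉ k (recordK₀ F Mc k + n) → (Fin (recordChartDimJ F (recordK₀ F Mc k + n)) → ℂ),
      (∀ (k : ℕ) (v : Fin (k + 1) → ℝ), v ∈ FlowStep.Box γ₀ k →
        B12FormatPlus.FormatPlusG (fun n => recordDomSys F Mc k (recordK₀ F Mc k + n)) (fun n => recordBondCount F (recordK₀ F Mc k + n))
          (fun n => recordAct F (recordK₀ F Mc k + n)) (fun n => recordUc F Mc k α₀ α₁ (recordK₀ F Mc k + n))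
          (fun n => recordCoords F Mc k (recordK₀ F Mc k + n)) (fun n => recordChartDimJ F (recordK₀ F Mc k + n))
          (fun n => recordChartJ F Mc k (recordK₀ F Mc k + n)) (fun n => recordΦfAx F a₀ ε₂₉ k v (recordK₀ F Mc k + n))
          (fun n => recordEmbJ F θ k (recordK₀ F Mc k + n)) (fun n => recordWrapCtr F Mc k (recordK₀ F Mc k + n))
          (fun n => recordDomEmbCtr F Mc k (recordK₀ F Mc k + n)) (fun n _ => recordCoordProjCtr F (recordK₀ F Mc k + n)) E₀ κ) →
      (∀ (k n : ℕ), ∀ᶠ B in 𝓝 (0 : recordW F a₀ ε₂₉ k (recordK₀ F Mc k + n)), ∀ X : (recordDomSys F Mc k (recordK₀ F Mc k + n)).Dom,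
          ∃ g : recordGaugeGrp F (recordK₀ F Mc k + n), ∀ i ∈ recordCoords F Mc k (recordK₀ F Mc k + n) X,
            recordChartJ F Mc k (recordK₀ F Mc k + n) X (ιC k n B) i =
              recordAct F (recordK₀ F Mc k + n) g (recordChartJ F Mc k (recordK₀ F Mc k + n) X (recordEmbJ F θ k (recordK₀ F Mc k + n) B)) i) →
      (∀ k : ℕ, (∀ n : ℕ, ContDiffAt ℝ 2 (ιC k n) 0 ∧ ιC k n 0 = 0) ∧
          ∀ (n : ℕ) (a : θ.ιβ) (l : RespLabel F k (recordK₀ F Mc k + n)),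
            recordGkLocWξ F θ k (recordK₀ F Mc k + n) Finset.univ a l = fun i => fderiv ℝ (ιC k n) 0 (Pi.single l.1 (Pi.single l.2 (θ.bV a))) i) →
      (∀ k K : ℕ, ContinuousOn (fun v : Fin (k + 1) → ℝ => fderiv ℝ (fderiv ℝ (B12PolarizationTensor120.expChart (recordTermsAx F a₀ ε₂₉ k v K) θ.ρ8)) 0) (FlowStep.Box γ₀ k)) →
      RecordPlimMomentNegPartOnBoxAx F a₀ ε₂₉ γ₀ e → CofinalBetaSocketAxBody F a := by
  intro F a₀ ε₂₉ γ₀ α₀ α₁ ha₀ hle hγ₀ hγh hε hα₀ hα₁ Mc hMc hMg4 ιC h8 hsw h9 hH hneg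
  exact cofinalBetaSocketAxBody_of_chartRowsBox_contBox_negPart hE₀ hκ₀ F a₀ ε₂₉ γ₀ α₀ α₁ ha₀ hle hγ₀ hγh hε hα₀ hα₁ Mc hMc hMg4 ιC h8 hsw h9
    (recordPvolContOnBoxAx_of_hessContOnBox F a₀ ε₂₉ hH) hneg

/-- ★ **THE JUNCTION's `hβc` FROM D1-box + THE CHART ROWS + (V-hess-cont-box) + THE SIGNED FLOOR LETTER AT COFINALLY SMALL RADII** (= №9 v2.1 §11i with (V-cont-box) ↦ (V-hess-cont-box)):
inhabits `∀ F a, 0 < a → CofinalBetaSocketAxBody F a` VERBATIM.  CONDITIONAL door: every conjunct of `H` is OPEN content; the junction's consumer, K0ᴬ, K1ᴬ, K3ᴬ remain OPEN; NODE O 0∕1;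
the Yang–Mills mass gap is NOT proved. [cite: Balaban1987RG1, Thm 1 p.259, Thm 2 (0.31) p.259, Thm 3 p.264, (1.18)–(1.22) pp.263–264, p.266, (5.10) p.293, (5.38)–(5.44) pp.296–297] -/
theorem cofinalBetaSocketAxBody_allRadii_of_chartRowsBox_hessBox_negPart_cofinalRadii
    (H : ∀ F : T4Family, ∀ a : ℝ, 0 < a → ∃ a₀ : ℝ, 0 < a₀ ∧ a₀ ≤ a ∧ ∃ (γ₀ ε₂₉ E₀ κ Mg α₀ α₁ : ℝ) (Mc : ℕ) (e : ℕ → ℝ),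
      0 < γ₀ ∧ γ₀ ≤ 1 / 2 ∧ 0 < ε₂₉ ∧ 0 ≤ E₀ ∧ 4 * B12TreeDecay.kappa₀ (4 * 2 ^ 4) (2 * 4) ≤ κ ∧ 0 < α₀ ∧ 0 < α₁ ∧ McGuard F Mc ∧ 4 * (Mc : ℝ) ≤ Mg ∧
      RecordPlimMomentNegPartOnBoxAx F a₀ ε₂₉ γ₀ e ∧
      (letI θ := thetaFill F a₀ ε₂₉; letI := θ.instVβ₁; letI := θ.instVβ₂; letI := θ.instιβ;
        (∀ k K : ℕ, ContinuousOn (fun v : Fin (k + 1) → ℝ => fderiv ℝ (fderiv ℝ (B12PolarizationTensor120.expChart (recordTermsAx F a₀ ε₂₉ k v K) θ.ρ8)) 0) (FlowStep.Box γ₀ k)) ∧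
        ∃ ιC : (k n : ℕ) → recordW F a₀ ε₂₉ k (recordK₀ F Mc k + n) → (Fin (recordChartDimJ F (recordK₀ F Mc k + n)) → ℂ),
        (∀ (k : ℕ) (v : Fin (k + 1) → ℝ), v ∈ FlowStep.Box γ₀ k →
          B12FormatPlus.FormatPlusG (fun n => recordDomSys F Mc k (recordK₀ F Mc k + n)) (fun n => recordBondCount F (recordK₀ F Mc k + n))
            (fun n => recordAct F (recordK₀ F Mc k + n)) (fun n => recordUc F Mc k α₀ α₁ (recordK₀ F Mc k + n))
            (fun n => recordCoords F Mc k (recordK₀ F Mc k + n)) (fun n => recordChartDimJ F (recordK₀ F Mc k + n))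
            (fun n => recordChartJ F Mc k (recordK₀ F Mc k + n)) (fun n => recordΦfAx F a₀ ε₂₉ k v (recordK₀ F Mc k + n))
            (fun n => recordEmbJ F θ k (recordK₀ F Mc k + n)) (fun n => recordWrapCtr F Mc k (recordK₀ F Mc k + n))
            (fun n => recordDomEmbCtr F Mc k (recordK₀ F Mc k + n)) (fun n _ => recordCoordProjCtr F (recordK₀ F Mc k + n)) E₀ κ) ∧
        (∀ (k n : ℕ), ∀ᶠ B in 𝓝 (0 : recordW F a₀ ε₂₉ k (recordK₀ F Mc k + n)), ∀ X : (recordDomSys F Mc k (recordK₀ F Mc k + n)).Dom,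
            ∃ g : recordGaugeGrp F (recordK₀ F Mc k + n), ∀ i ∈ recordCoords F Mc k (recordK₀ F Mc k + n) X,
              recordChartJ F Mc k (recordK₀ F Mc k + n) X (ιC k n B) i =
                recordAct F (recordK₀ F Mc k + n) g (recordChartJ F Mc k (recordK₀ F Mc k + n) X (recordEmbJ F θ k (recordK₀ F Mc k + n) B)) i) ∧
        (∀ k : ℕ, (∀ n : ℕ, ContDiffAt ℝ 2 (ιC k n) 0 ∧ ιC k n 0 = 0) ∧
            ∀ (n : ℕ) (a : θ.ιβ) (l : RespLabel F k (recordK₀ F Mc k + n)),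
              recordGkLocWξ F θ k (recordK₀ F Mc k + n) Finset.univ a l = fun i => fderiv ℝ (ιC k n) 0 (Pi.single l.1 (Pi.single l.2 (θ.bV a))) i))) :
    ∀ F : T4Family, ∀ a : ℝ, 0 < a → CofinalBetaSocketAxBody F a := by
  intro F a ha
  obtain ⟨a₀, ha₀, hle, γ₀, ε₂₉, E₀, κ, Mg, α₀, α₁, Mc, e, hγ₀, hγh, hε, hE₀, hκ₀, hα₀, hα₁, hMc, hMg4, hneg, hH, ιC, h8, hsw, h9⟩ := H F a ha
  exact cofinalBetaSocketAxBody_of_chartRowsBox_hessBox_negPart hE₀ hκ₀ F a₀ ε₂₉ γ₀ α₀ α₁ ha₀ hle hγ₀ hγh hε hα₀ hα₁ Mc hMc hMg4 ιC h8 hsw h9 hH hneg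

/-- ★ **… hence K0ᴬ BY NAME through the junction body** (✓`record13SepCoPHInhabitedAx_of_cofinalBetaSocketAxBody`; recorded so the Hessian edition sits on the K0ᴬ edge).  CONDITIONAL; K0ᴬ OPEN;
the Yang–Mills mass gap is NOT proved. [cite: Balaban1987RG1, Thm 1 p.259, Thm 3 p.264 (bookkeeping)] -/
theorem record13SepCoPHInhabitedAx_of_chartRowsBox_hessBox_negPart_cofinalRadii
    (H : ∀ F : T4Family, ∀ a : ℝ, 0 < a → ∃ a₀ : ℝ, 0 < a₀ ∧ a₀ ≤ a ∧ ∃ (γ₀ ε₂₉ E₀ κ Mg α₀ α₁ : ℝ) (Mc : ℕ) (e : ℕ → ℝ),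
      0 < γ₀ ∧ γ₀ ≤ 1 / 2 ∧ 0 < ε₂₉ ∧ 0 ≤ E₀ ∧ 4 * B12TreeDecay.kappa₀ (4 * 2 ^ 4) (2 * 4) ≤ κ ∧ 0 < α₀ ∧ 0 < α₁ ∧ McGuard F Mc ∧ 4 * (Mc : ℝ) ≤ Mg ∧
      RecordPlimMomentNegPartOnBoxAx F a₀ ε₂₉ γ₀ e ∧
      (letI θ := thetaFill F a₀ ε₂₉; letI := θ.instVβ₁; letI := θ.instVβ₂; letI := θ.instιβ;
        (∀ k K : ℕ, ContinuousOn (fun v : Fin (k + 1) → ℝ => fderiv ℝ (fderiv ℝ (B12PolarizationTensor120.expChart (recordTermsAx F a₀ ε₂₉ k v K) θ.ρ8)) 0) (FlowStep.Box γ₀ k)) ∧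
        ∃ ιC : (k n : ℕ) → recordW F a₀ ε₂₉ k (recordK₀ F Mc k + n) → (Fin (recordChartDimJ F (recordK₀ F Mc k + n)) → ℂ),
        (∀ (k : ℕ) (v : Fin (k + 1) → ℝ), v ∈ FlowStep.Box γ₀ k →
          B12FormatPlus.FormatPlusG (fun n => recordDomSys F Mc k (recordK₀ F Mc k + n)) (fun n => recordBondCount F (recordK₀ F Mc k + n))
            (fun n => recordAct F (recordK₀ F Mc k + n)) (fun n => recordUc F Mc k α₀ α₁ (recordK₀ F Mc k + n))
            (fun n => recordCoords F Mc k (recordK₀ F Mc k + n)) (fun n => recordChartDimJ F (recordK₀ F Mc k + n))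
            (fun n => recordChartJ F Mc k (recordK₀ F Mc k + n)) (fun n => recordΦfAx F a₀ ε₂₉ k v (recordK₀ F Mc k + n))
            (fun n => recordEmbJ F θ k (recordK₀ F Mc k + n)) (fun n => recordWrapCtr F Mc k (recordK₀ F Mc k + n))
            (fun n => recordDomEmbCtr F Mc k (recordK₀ F Mc k + n)) (fun n _ => recordCoordProjCtr F (recordK₀ F Mc k + n)) E₀ κ) ∧
        (∀ (k n : ℕ), ∀ᶠ B in 𝓝 (0 : recordW F a₀ ε₂₉ k (recordK₀ F Mc k + n)), ∀ X : (recordDomSys F Mc k (recordK₀ F Mc k + n)).Dom,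
            ∃ g : recordGaugeGrp F (recordK₀ F Mc k + n), ∀ i ∈ recordCoords F Mc k (recordK₀ F Mc k + n) X,
              recordChartJ F Mc k (recordK₀ F Mc k + n) X (ιC k n B) i =
                recordAct F (recordK₀ F Mc k + n) g (recordChartJ F Mc k (recordK₀ F Mc k + n) X (recordEmbJ F θ k (recordK₀ F Mc k + n) B)) i) ∧
        (∀ k : ℕ, (∀ n : ℕ, ContDiffAt ℝ 2 (ιC k n) 0 ∧ ιC k n 0 = 0) ∧
            ∀ (n : ℕ) (a : θ.ιβ) (l : RespLabel F k (recordK₀ F Mc k + n)),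
              recordGkLocWξ F θ k (recordK₀ F Mc k + n) Finset.univ a l = fun i => fderiv ℝ (ιC k n) 0 (Pi.single l.1 (Pi.single l.2 (θ.bV a))) i))) :
    Summit.QuantumFields.YangMills.Theses.BalabanUVNodes.Record13SepCoPHInhabitedAx :=
  record13SepCoPHInhabitedAx_of_cofinalBetaSocketAxBody (cofinalBetaSocketAxBody_allRadii_of_chartRowsBox_hessBox_negPart_cofinalRadii H)

-- standard axioms only
#print axioms recordPvolContOnBoxAx_of_hessContOnBox
#print axioms record13SepCoPHInhabitedAx_of_chartRowsBox_hessBox_negPart_cofinalRadii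

end Summit.QuantumFields.YangMills.Theorems.K0AxMomentRoad

end
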